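import Literature.AlgebraicGeometry.Resolution.ResolutionLocalization
import Literature.AlgebraicGeometry.Resolution.RegularLocusOpen
import Literature.AlgebraicGeometry.Resolution.ExcellentRingsFieldProofs
import Summits.ResolutionOfSingularities.ResolutionOfSingularities.Theses.UniversalCells
import Summits.ResolutionOfSingularities.ResolutionOfSingularities.Theorems.UniversalCellsProductDescentSliceRegular
import Summits.ResolutionOfSingularities.ResolutionOfSingularities.Theorems.UniversalCellsProductDescentSliceResolution

/-!
# Wiggling a `p`-th power section into the isomorphism locus

Crux `ProductDescent` (stmt-ResolutionOfSingularities-15231), line `birth`, stub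
`stub_sliceWiggle` — in the CORRECTED form: the registered signature (skeleton `67f6a4ad042b`)
omits the hypothesis `σ_g(y) ∈ V₁` and is false for `V₁ = ⊥` (Lean counterexample `Y = Spec ℤ`,
`y = (2)`, `s = 0`, `π = 𝟙 ↑⊥` in the worker's evidence file
`work/stubs/stub_sliceWiggle_original_false.lean`); the statement below adds exactly the
hypothesis `(AffineSpace.homOfVector V.ι (fun i => g i ^ p)).base ⟨y, hyV⟩ ∈ V₁`, which the
lead's composition has in hand (`hb`).

Setting: `Y` an integral scheme, `p` a prime, `V₁ ⊆ 𝔸ˢ_Y` open, `π : X₁ → V₁` birational,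
`V ∋ y` open with `y ≠ η_Y`, `g : Fin s → Γ(V, 𝒪_Y)` with `p`-th power section
`σ_g := homOfVector V.ι (gᵢᵖ)ᵢ : V → 𝔸ˢ_Y` and `σ_g(y) ∈ V₁`. Conclusion: an open `V' ∋ y`,
sections `g'` on `V'` with `σ_{g'}(y) = σ_g(y)`, and an open `Ω ≤ V₁` with `π` an isomorphism
over `Ω` and `σ_{g'}(x) ∈ Ω` for every `x ∈ V'` over `η_Y`.

Proof.
* `Ω := V₁.ι '' U` for the dense open isomorphism locus `U` of `π`; an open of `𝔸ˢ_Y` meeting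
  `V₁` meets `Ω`.
* Shrink to an affine open `y ∈ W ⊆ V`, `W ≅ Spec R`, `R = Γ(W, 𝒪_Y)` a domain; `y` is a prime
  `𝔭 ≠ 0` of `R` (as `y ≠ η_Y`), so `R` is not a field, hence `R` and `𝔭` are infinite.
* The chart `Φ : Spec R[T₁,…,T_s] ≅ 𝔸ˢ_W → 𝔸ˢ_Y` is an open immersion and, for
  `w : Fin s → R`, `homOfVector W.ι w = (W ≅ Spec R) ≫ Spec(ev_w) ≫ Φ` with
  `ev_w : R[T] → R, Tᵢ ↦ wᵢ` (`sliceWiggle_homOfVector_fac`). Hence `σ_w(z) = Φ(ev_w⁻¹ 𝔮_z)`.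
* `Φ⁻¹ Ω` is a non-empty open of `Spec R[T]` (it contains a point over `σ_g(y) ∈ V₁`), so it
  contains a basic open `D(P)` with `P ≠ 0`.
* Vectors congruent mod `𝔭` give the same point over `𝔭` (`sliceWiggle_comap_eval_eq`), so
  `g' := g|_W + h` with `h ∈ 𝔭ˢ` keeps `σ_{g'}(y) = σ_g(y)`; and the point of `Spec R[T]` under
  `σ_{g'}(η)` is `ker ev_{(g'ᵖ)}`, which lies in `D(P)` iff `P((g|_W + h)ᵖ) ≠ 0`. Such an `h`
  exists: `H ↦ P((g + H)ᵖ)` is `expand p` followed by a translation, hence non-zero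
  (`sliceWiggle_bind₁_expand_ne_zero`), and a non-zero polynomial over a domain does not vanish
  on the infinite box `𝔭ˢ` (`MvPolynomial.funext_set`; `sliceWiggle_exists_eval_ne_zero`).

All statements are folklore; no named fact is introduced.

## The reduction of the crux to separabilisation (conditional theorem, appended by the lead)

`ProductDescent_of_separabilisation`: the crux `UniversalCells.ProductDescent` follows from the
single remaining open statement of line `birth` (rev L6), SEPARABILISATION WITH A RATIONAL p-TH
POWER POINT — taken here as an explicit hypothesis written out in full (it is the registered stub
`stub_separabilisation` of the crux skeleton `Cruxes/ProductDescent/Lines/birth.lean`; open,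
implied by the summit) — by the p-th power section method: wiggle (this file), regularity of the
slice (`…SliceRegular`, p153336, using `…PthPowerSliceAlgebra`, p151341), and resolution of a
neighbourhood (`…SliceResolution`, p151654); the generic point of `Y` is treated separately through
the openness of the regular locus (`isOpen_regularLocus_of_locallyOfFiniteType`,
`Stacks07QW_field_holds`). This records kernel-checkably that the crux REDUCES to separabilisation.
-/

noncomputable section

set_option linter.dupNamespace false

open CategoryTheory CategoryTheory.Limits AlgebraicGeometry Literature.AlgebraicGeometry.Resolution

namespace Summit.ResolutionOfSingularities.ResolutionOfSingularities.Theorems.ProductDescent.Birth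

universe u

/-- Translating and then raising the variables to the `p`-th power does not kill a non-zero
polynomial: over a domain `R`, for `P ≠ 0`, `0 < p` and any vector `g`, the polynomial
`H ↦ P((gᵢ + Hᵢ)ᵖ)ᵢ` is non-zero. [folklore] -/
theorem sliceWiggle_bind₁_expand_ne_zero {R : Type*} [CommRing R] [IsDomain R] {σ : Type*}
    {p : ℕ} (hp : 0 < p) (g : σ → R) {P : MvPolynomial σ R} (hP : P ≠ 0) :
    MvPolynomial.bind₁ (fun i => MvPolynomial.C (g i) + MvPolynomial.X i)
      (MvPolynomial.expand p P) ≠ 0 := by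
  intro h
  apply (MvPolynomial.expand_ne_zero hp).mpr hP
  have h' := congrArg (MvPolynomial.bind₁ (fun i => MvPolynomial.X i - MvPolynomial.C (g i))) h
  rw [MvPolynomial.bind₁_bind₁, map_zero] at h'
  simpa [MvPolynomial.bind₁_X_right, MvPolynomial.bind₁_C_right] using h'

/-- Over a domain, a non-zero polynomial does not vanish identically on a box with infinite
sides (`MvPolynomial.funext_set`); applied to `H ↦ P((gᵢ + Hᵢ)ᵖ)ᵢ` and the box `Sᶥ`.
[folklore] -/
theorem sliceWiggle_exists_eval_ne_zero {R : Type*} [CommRing R] [IsDomain R] {σ : Type*}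
    {p : ℕ} (hp : 0 < p) (g : σ → R) {P : MvPolynomial σ R} (hP : P ≠ 0)
    (S : Set R) (hS : S.Infinite) :
    ∃ h : σ → R, (∀ i, h i ∈ S) ∧ MvPolynomial.eval (fun i => (g i + h i) ^ p) P ≠ 0 := by
  have hQ := sliceWiggle_bind₁_expand_ne_zero hp g hP
  by_contra hcon
  push Not at hcon
  apply hQ
  apply MvPolynomial.funext_set (fun _ => S) (fun _ => hS)
  intro x hx
  have hxS : ∀ i, x i ∈ S := fun i => hx i (Set.mem_univ i)
  rw [map_zero, ← MvPolynomial.aeval_eq_eval, MvPolynomial.aeval_bind₁]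
  simpa [MvPolynomial.aeval_expand, Pi.pow_def] using hcon x hxS

/-- Vectors congruent modulo a prime `𝔭` of `R` define sections `Spec R → Spec R[T]` with the
same value at `𝔭`. [folklore] -/
theorem sliceWiggle_comap_eval_eq {R : Type*} [CommRing R] {σ : Type*}
    (𝔭 : PrimeSpectrum R) {v₁ v₂ : σ → R} (h : ∀ i, v₁ i - v₂ i ∈ 𝔭.asIdeal) :
    PrimeSpectrum.comap (MvPolynomial.eval v₁) 𝔭 =
      PrimeSpectrum.comap (MvPolynomial.eval v₂) 𝔭 := by
  have key : ∀ Q : MvPolynomial σ R,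
      MvPolynomial.eval v₁ Q - MvPolynomial.eval v₂ Q ∈ 𝔭.asIdeal := by
    intro Q
    rw [← Ideal.Quotient.eq]
    change Ideal.Quotient.mk 𝔭.asIdeal (MvPolynomial.eval₂ (RingHom.id R) v₁ Q) =
      Ideal.Quotient.mk 𝔭.asIdeal (MvPolynomial.eval₂ (RingHom.id R) v₂ Q)
    rw [MvPolynomial.eval₂_comp_left, MvPolynomial.eval₂_comp_left]
    congr 1
    funext i
    exact Ideal.Quotient.eq.mpr (h i)
  apply PrimeSpectrum.ext
  ext Q
  simp only [PrimeSpectrum.comap_asIdeal, Ideal.mem_comap]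
  constructor
  · intro H; simpa using 𝔭.asIdeal.sub_mem H (key Q)
  · intro H; simpa using 𝔭.asIdeal.add_mem (key Q) H

/-- For an affine scheme `Z` over `Y` (via `j`), the morphism `homOfVector j w : Z → 𝔸ⁿ_Y`
defined by a vector `w` of global sections factors as
`Z ≅ Spec Γ(Z) → Spec Γ(Z)[T] ≅ 𝔸ⁿ_Z → 𝔸ⁿ_Y`, the second arrow being `Spec` of the evaluation
`Tᵢ ↦ wᵢ`. [folklore] -/
theorem sliceWiggle_homOfVector_fac {Z Y : Scheme.{u}} [IsAffine Z] (j : Z ⟶ Y) {n : Type u}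
    (w : n → Γ(Z, ⊤)) :
    Z.isoSpec.hom ≫ Spec.map (CommRingCat.ofHom (MvPolynomial.eval w)) ≫
      (AffineSpace.isoOfIsAffine n Z).inv ≫ AffineSpace.map n j =
        AffineSpace.homOfVector j w := by
  have hC : (MvPolynomial.eval w).comp MvPolynomial.C = RingHom.id _ :=
    RingHom.ext fun a => MvPolynomial.eval_C a
  refine AffineSpace.hom_ext ?_ (fun i => ?_)
  · simp only [Category.assoc, AffineSpace.map_over, AffineSpace.isoOfIsAffine_inv_over_assoc,
      AffineSpace.homOfVector_over]
    rw [← Spec.map_comp_assoc, ← CommRingCat.ofHom_comp, hC, CommRingCat.ofHom_id, Spec.map_id,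
      Category.id_comp, Iso.hom_inv_id_assoc]
  · simp only [Scheme.Hom.comp_appTop, CommRingCat.comp_apply, AffineSpace.map_appTop_coord,
      AffineSpace.isoOfIsAffine_inv_appTop_coord, AffineSpace.homOfVector_appTop_coord]
    rw [← CommRingCat.comp_apply _ (Spec.map _).appTop, ← Scheme.ΓSpecIso_inv_naturality,
      CommRingCat.comp_apply, Scheme.isoSpec_hom, Scheme.toSpecΓ_appTop]
    simp

/-- **WIGGLING THE SECTION** (stub `stub_sliceWiggle` of the line `birth` of the crux
`ProductDescent`, corrected by the hypothesis that the section value `σ_g(y)` lies in `V₁`). For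
`y` not the generic point of the integral scheme `Y`, an open `V ∋ y`, sections
`g : Fin s → Γ(V, 𝒪_Y)` whose `p`-th power section `σ_g = (gᵢᵖ)ᵢ : V → 𝔸ˢ_Y` takes at `y` a
value in the open `V₁ ⊆ 𝔸ˢ_Y`, and a birational `π : X₁ → V₁`: there are an open `V' ∋ y` and
sections `g'` on `V'` with `σ_{g'}(y) = σ_g(y)` and an open `Ω ⊆ V₁` over which `π` is an
isomorphism and which contains the generic value of `σ_{g'}`. Proof: `Ω` is the (image of
the) dense open isomorphism locus of `π`; on an affine neighbourhood `V' = W ≅ Spec A` of `y`,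
`y` is a non-zero prime `𝔭` of the domain `A` (so `A` and `𝔭` are infinite), `σ_{v}` factors
through `Spec` of the evaluation `A[T] → A, Tᵢ ↦ vᵢ`, the preimage of `Ω` in `Spec A[T]`
contains a basic open `D(P)`, `P ≠ 0`, and `g' := g|_W + h` with `h ∈ 𝔭ˢ` chosen so that
`P((g + h)ᵖ) ≠ 0` (`H ↦ P((g + H)ᵖ)` is a non-zero polynomial, which cannot vanish on the
infinite box `𝔭ˢ`). [folklore] -/
theorem stub_sliceWiggle :
    ∀ p : ℕ, p.Prime → ∀ (Y : Scheme.{0}) [IsIntegral Y] (s : ℕ)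
      (V₁ : (AffineSpace (Fin s) Y).Opens) (X₁ : Scheme.{0}) (π : X₁ ⟶ (V₁ : Scheme.{0})),
      IsBirational π →
      ∀ (V : Y.Opens) (y : Y) (hyV : y ∈ V), y ≠ genericPoint Y →
      ∀ g : Fin s → Γ((V : Scheme.{0}), ⊤),
      (AffineSpace.homOfVector V.ι (fun i => g i ^ p)).base ⟨y, hyV⟩ ∈ V₁ →
      ∃ (V' : Y.Opens) (hyV' : y ∈ V') (g' : Fin s → Γ((V' : Scheme.{0}), ⊤)),
        (AffineSpace.homOfVector V'.ι (fun i => g' i ^ p)).base ⟨y, hyV'⟩ =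
          (AffineSpace.homOfVector V.ι (fun i => g i ^ p)).base ⟨y, hyV⟩ ∧
        ∃ Ω : (AffineSpace (Fin s) Y).Opens, Ω ≤ V₁ ∧ IsIso (π ∣_ (V₁.ι ⁻¹ᵁ Ω)) ∧
          ∀ x : (V' : Scheme.{0}), V'.ι.base x = genericPoint Y →
            (AffineSpace.homOfVector V'.ι (fun i => g' i ^ p)).base x ∈ Ω := by
  intro p hp Y _ s V₁ X₁ π hπ V y hyV hyη g hb
  /- (1) The isomorphism locus `Ω := V₁.ι '' U` of `π`. -/
  obtain ⟨U, hUd, -, hUiso⟩ := hπ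
  have hΩiso : IsIso (π ∣_ (V₁.ι ⁻¹ᵁ (V₁.ι ''ᵁ U))) := by
    have key : ∀ U' : (V₁ : Scheme.{0}).Opens, U' = U → IsIso (π ∣_ U') := by
      rintro _ rfl; exact hUiso
    exact key _ (V₁.ι.preimage_image_eq U)
  -- an open of `𝔸ˢ_Y` meeting `V₁` meets the dense `Ω`
  have hΩmeet : ∀ O : (𝔸(Fin s; Y)).Opens, (∃ v, v ∈ V₁ ∧ v ∈ O) →
      ∃ ω, ω ∈ V₁.ι ''ᵁ U ∧ ω ∈ O := by
    rintro O ⟨v, hvV₁, hvO⟩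
    obtain ⟨u, huO, huU⟩ := hUd.inter_open_nonempty _ (V₁.ι ⁻¹ᵁ O).isOpen ⟨⟨v, hvV₁⟩, hvO⟩
    exact ⟨V₁.ι.base u, ⟨u, huU, rfl⟩, huO⟩
  /- (2) An affine open neighbourhood `W ≅ Spec R` of `y` inside `V`; `R` is a domain. -/
  obtain ⟨W, hW, hyW, hWV⟩ := exists_isAffineOpen_mem_and_subset hyV
  have hWV' : W ≤ V := hWV
  haveI : IsAffine (W : Scheme.{0}) := hW
  haveI : Nonempty W := ⟨⟨y, hyW⟩⟩
  let R : CommRingCat.{0} := Γ((W : Scheme.{0}), ⊤)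
  haveI : IsDomain R := inferInstanceAs (IsDomain Γ((W : Scheme.{0}), ⊤))
  let e : (W : Scheme.{0}) ≅ Spec R := (W : Scheme.{0}).isoSpec
  let f₀ : Spec R ⟶ Y := e.inv ≫ W.ι
  have hf₀W : e.hom ≫ f₀ = W.ι := e.hom_inv_id_assoc W.ι
  -- the restriction `ρ : Γ(V) → Γ(W) = R` and its effect on the sections `σ`
  let ρ : Γ((V : Scheme.{0}), ⊤) ⟶ R := (Y.homOfLE hWV').appTop
  have hρ : ∀ z : W,
      (AffineSpace.homOfVector V.ι (fun i => g i ^ p)).base ((Y.homOfLE hWV').base z) =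
        (AffineSpace.homOfVector W.ι (fun i => ρ (g i) ^ p)).base z := by
    intro z
    rw [← Scheme.Hom.comp_apply, AffineSpace.comp_homOfVector, Scheme.homOfLE_ι]
    simp only [Function.comp_def, map_pow]
    rfl
  /- (3) The chart `Φ : Spec R[T] ≅ 𝔸ˢ_W → 𝔸ˢ_Y` (an open immersion) and the factorisation of
  the sections `σ_w`, `w : Fin s → R`, through `Spec` of the evaluation maps. -/
  haveI : IsOpenImmersion (AffineSpace.map (Fin s) W.ι) :=
    MorphismProperty.of_isPullback (P := @IsOpenImmersion)
      (AffineSpace.isPullback_map W.ι).flip inferInstance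
  obtain ⟨Φ, hΦ⟩ : ∃ Φ : Spec (.of (MvPolynomial (Fin s) R)) ⟶ 𝔸(Fin s; Y),
      Φ = (AffineSpace.isoOfIsAffine (Fin s) (W : Scheme.{0})).inv ≫ AffineSpace.map (Fin s) W.ι :=
    ⟨_, rfl⟩
  haveI : IsOpenImmersion Φ := by rw [hΦ]; infer_instance
  have hfac : ∀ (w : Fin s → R) (z : W), (AffineSpace.homOfVector W.ι w).base z =
      Φ.base ((Spec.map (CommRingCat.ofHom (MvPolynomial.eval w))).base (e.hom.base z)) := by
    intro w z
    rw [← sliceWiggle_homOfVector_fac W.ι w, hΦ]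
    rfl
  /- (4) `y` corresponds to a non-zero prime `𝔭` of `R`; points over the generic point of `Y`
  correspond to the zero ideal. -/
  have hgen : ∀ z : W, W.ι.base z = genericPoint Y → e.hom.base z = (⊥ : PrimeSpectrum R) := by
    intro z hz
    rw [← genericPoint_eq_bot_of_affine R]
    apply f₀.isOpenEmbedding.injective
    rw [genericPoint_eq_of_isOpenImmersion f₀, ← Scheme.Hom.comp_apply, hf₀W]
    exact hz
  have h𝔭ne : (e.hom.base ⟨y, hyW⟩).asIdeal ≠ ⊥ := by
    intro h𝔭
    apply hyη
    calc y = W.ι.base ⟨y, hyW⟩ := rfl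
      _ = f₀.base (e.hom.base ⟨y, hyW⟩) := by rw [← Scheme.Hom.comp_apply, hf₀W]
      _ = f₀.base (genericPoint (Spec R)) := by
          rw [genericPoint_eq_bot_of_affine]
          exact congrArg f₀.base (PrimeSpectrum.ext h𝔭)
      _ = genericPoint Y := genericPoint_eq_of_isOpenImmersion f₀
  -- hence `R` is not a field, so `R` and `𝔭` are infinite
  haveI : Infinite R := by
    refine not_finite_iff_infinite.mp fun hfin => ?_
    exact Ring.not_isField_iff_exists_prime.mpr ⟨_, h𝔭ne, (e.hom.base ⟨y, hyW⟩).isPrime⟩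
      (Finite.isField_of_domain R)
  have h𝔭inf : ((e.hom.base ⟨y, hyW⟩).asIdeal : Set R).Infinite := by
    obtain ⟨a, ha, ha0⟩ := Submodule.exists_mem_ne_zero_of_ne_bot h𝔭ne
    exact Set.infinite_of_injective_forall_mem (mul_right_injective₀ ha0)
      (fun x : R => (e.hom.base ⟨y, hyW⟩).asIdeal.mul_mem_right x ha)
  /- (5) The preimage of `Ω` under `Φ` contains a basic open `D(P)`, `P ≠ 0`: it is a non-empty
  open of `Spec R[T]` since `σ_g(y) ∈ V₁` lies in the range of `Φ` and `Ω` is dense in `V₁`. -/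
  obtain ⟨P, hP0, hPΩ⟩ : ∃ P : MvPolynomial (Fin s) R, P ≠ 0 ∧
      ∀ q : Spec (.of (MvPolynomial (Fin s) R)), P ∉ q.asIdeal → Φ.base q ∈ V₁.ι ''ᵁ U := by
    have hbΦ : (AffineSpace.homOfVector V.ι (fun i => g i ^ p)).base ⟨y, hyV⟩ ∈ Φ.opensRange := by
      refine ⟨(Spec.map (CommRingCat.ofHom (MvPolynomial.eval fun i => ρ (g i) ^ p))).base
        (e.hom.base ⟨y, hyW⟩), ?_⟩
      rw [← hfac, ← hρ, Scheme.homOfLE_apply']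
    obtain ⟨ω, hωΩ, q, rfl⟩ := hΩmeet Φ.opensRange ⟨_, hb, hbΦ⟩
    obtain ⟨_, ⟨P, rfl⟩, hqP, hPsub⟩ :=
      (PrimeSpectrum.isTopologicalBasis_basic_opens (R := MvPolynomial (Fin s) R))
        |>.exists_subset_of_mem_open
        (show q ∈ ((Φ ⁻¹ᵁ (V₁.ι ''ᵁ U) : (Spec _).Opens) : Set _) from hωΩ)
        (Φ ⁻¹ᵁ (V₁.ι ''ᵁ U)).isOpen
    refine ⟨P, ?_, fun q' hq' => hPsub ((PrimeSpectrum.mem_basicOpen _ _).mpr hq')⟩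
    rintro rfl
    exact (PrimeSpectrum.mem_basicOpen _ _).mp hqP (zero_mem _)
  /- (6) Choose `h ∈ 𝔭ˢ` with `P((ρ g + h)ᵖ) ≠ 0` and put `g' := ρ g + h` on `V' := W`. -/
  obtain ⟨h, hh𝔭, hev⟩ :=
    sliceWiggle_exists_eval_ne_zero hp.pos (fun i => ρ (g i)) hP0 _ h𝔭inf
  refine ⟨W, hyW, fun i => ρ (g i) + h i, ?_, V₁.ι ''ᵁ U, V₁.ι_image_le U, hΩiso, ?_⟩
  · -- the value at `y` is unchanged: `(ρ g + h)ᵖ ≡ (ρ g)ᵖ (mod 𝔭)`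
    have hR : (AffineSpace.homOfVector V.ι (fun i => g i ^ p)).base ⟨y, hyV⟩ =
        Φ.base ((Spec.map (CommRingCat.ofHom (MvPolynomial.eval fun i => ρ (g i) ^ p))).base
          (e.hom.base ⟨y, hyW⟩)) := by
      rw [← hfac, ← hρ, Scheme.homOfLE_apply']
    rw [hfac, hR]
    refine congrArg (fun q => Φ.base q) ?_
    rw [Spec.map_apply, Spec.map_apply, CommRingCat.hom_ofHom, CommRingCat.hom_ofHom]
    refine sliceWiggle_comap_eval_eq _ fun i => ?_
    exact Ideal.mem_of_dvd _ (sub_dvd_pow_sub_pow _ _ p) (by simpa using hh𝔭 i)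
  · -- the generic value lies in `D(P) ⊆ Φ⁻¹ Ω`
    intro x hx
    rw [hfac, hgen x hx]
    apply hPΩ
    rw [Spec.map_apply, CommRingCat.hom_ofHom, PrimeSpectrum.comap_asIdeal,
      PrimeSpectrum.asIdeal_bot, Ideal.mem_comap, Ideal.mem_bot]
    exact hev


/-! ## The crux reduces to separabilisation -/

/-- **The generic point of an integral scheme locally of finite type over `𝔽_p` has a resolvable
(indeed regular) open neighbourhood** — the regular locus, open by excellence of finite-type
algebras over a field (`isOpen_regularLocus_of_locallyOfFiniteType` with `Stacks07QW_field_holds`),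
which contains the generic point because its local ring is the function field.
[cite: StacksProject, Tag 07QW] -/
theorem productDescent_exists_resolvable_nhd_genericPoint (p : ℕ) (Y : Scheme.{0})
    (f : Y ⟶ Spec (.of (ZMod p))) [IsIntegral Y] [LocallyOfFiniteType f] (hp : p.Prime) :
    ∃ U : Y.Opens, genericPoint Y ∈ U ∧ Scheme.HasResolution (U : Scheme.{0}) := by
  haveI : Fact p.Prime := ⟨hp⟩
  have hk : Scheme.IsQuasiExcellent (Spec (.of (ZMod p))) :=
    Scheme.isQuasiExcellent_of_locallyOfFiniteType Stacks07QW_field_holds (𝟙 (Spec (.of (ZMod p))))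
  have hopen : IsOpen (Scheme.regularLocus Y) := isOpen_regularLocus_of_locallyOfFiniteType f hk
  let U : Y.Opens := ⟨Scheme.regularLocus Y, hopen⟩
  have hη : genericPoint Y ∈ U := by
    change IsRegularLocalRing (Y.presheaf.stalk (genericPoint Y))
    change IsRegularLocalRing Y.functionField
    infer_instance
  refine ⟨U, hη, Scheme.IsRegular.hasResolution ?_⟩
  intro x
  have hx : IsRegularLocalRing (Y.presheaf.stalk (U.ι.base x)) := x.2
  exact IsRegularLocalRing.of_ringEquiv (asIso (U.ι.stalkMap x)).commRingCatIsoToRingEquiv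

/-- **`ProductDescent` REDUCES TO SEPARABILISATION** (line `birth`, rev L6, p-th power section
method). Hypothesis `hsep` is, verbatim, the registered open stub `stub_separabilisation`: from the
crux data produce a local resolution `π : X₁ → V₁ ⊆ 𝔸ˢ_Y`, an open `V ∋ y` and sections `g` with
the p-th power section value `b = (gᵢ(y)ᵖ) ∈ V₁` and `X₁ → 𝔸ˢ_{𝔽_p}` smooth along `π⁻¹(b)`.
Conclusion: the crux. Proof: for `y = η_Y` the regular locus; otherwise wiggle the section
(`stub_sliceWiggle`), slice (`stub_sliceRegular`: the slice is regular over an open `O ∋ b` since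
`d(gᵖ) = 0`), and resolve the neighbourhood `σ⁻¹(O ∩ V₁)` (`stub_sliceResolution`).
[cite: EGAIV4, 17.11.1; Matsumura1987, Thm. 14.2] -/
theorem ProductDescent_of_separabilisation
    (hsep : ∀ p : ℕ, p.Prime → ∀ (Y : Scheme.{0}) (f : Y ⟶ Spec (.of (ZMod p))),
      IsSeparated f → LocallyOfFiniteType f → QuasiCompact f → IsIntegral Y →
      ∀ (s : ℕ) (W : Scheme.{0}) (j : W ⟶ AffineSpace (Fin s) Y), IsOpenImmersion j →
      ∀ w : W, (∃ W' : W.Opens, w ∈ W' ∧ Scheme.HasResolution (W' : Scheme.{0})) →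
      ∃ (V₁ : (AffineSpace (Fin s) Y).Opens) (X₁ : Scheme.{0}) (π : X₁ ⟶ (V₁ : Scheme.{0})),
        IsResolution π ∧
        ∃ (V : Y.Opens) (hyV : (CategoryTheory.over (AffineSpace (Fin s) Y) Y).base (j.base w) ∈ V)
          (g : Fin s → Γ((V : Scheme.{0}), ⊤)),
          (AffineSpace.homOfVector V.ι (fun i => g i ^ p)).base ⟨_, hyV⟩ ∈ V₁ ∧
          ∃ _ : LocallyOfFinitePresentation (π ≫ V₁.ι ≫ AffineSpace.map (Fin s) f),
            ∀ x : X₁, (π ≫ V₁.ι).base x =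
                (AffineSpace.homOfVector V.ι (fun i => g i ^ p)).base ⟨_, hyV⟩ →
              x ∈ (π ≫ V₁.ι ≫ AffineSpace.map (Fin s) f).smoothLocus) :
    Summit.ResolutionOfSingularities.ResolutionOfSingularities.Theses.UniversalCells.ProductDescent := by
  intro p hp Y f hs hl hq hi s W j hj w hw
  set y := (CategoryTheory.over (AffineSpace (Fin s) Y) Y).base (j.base w) with hy_def
  by_cases hyη : y = genericPoint Y
  · obtain ⟨U, hU, hres⟩ := productDescent_exists_resolvable_nhd_genericPoint p Y f hp
    exact ⟨U, hyη ▸ hU, hres⟩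
  obtain ⟨V₁, X₁, π, hπ, V, hyV, g, hb, hfp, hsm⟩ := hsep p hp Y f hs hl hq hi s W j hj w hw
  haveI := hπ.isProper
  haveI := hfp
  obtain ⟨V', hyV', g', hpt, Ω, hΩV₁, hiso, hgen⟩ :=
    stub_sliceWiggle p hp Y s V₁ X₁ π hπ.isBirational V y hyV hyη g hb
  rw [← hpt] at hb hsm
  obtain ⟨O, hbO, hreg⟩ := stub_sliceRegular p hp Y f s V₁ X₁ π hπ.isRegular V' y hyV' g' hb hsm
  exact stub_sliceResolution p hp Y f s V₁ X₁ π V' y hyV' (fun i => g' i ^ p) Ω hΩV₁ hiso hgen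
    (O ⊓ V₁) ⟨hbO, hb⟩ inf_le_right (fun z hz => hreg z hz.1)

end Summit.ResolutionOfSingularities.ResolutionOfSingularities.Theorems.ProductDescent.Birth

end
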